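/-
Copyright: b2b-lace packet (literature seat, gen 6).  F-IM (b2b-lace D41 / C22 (ii)): the sup over
an INFINITE `x`-region of the signed SRW combination `𝓙_{n,l}(x)` ([NoBLE17] (3.30), Fitzner's
thesis (3.6.18), `SRW.nb` `IM[n,l,x]`) is reduced to finitely many evaluations WITHOUT any
monotonicity claim on `𝓙`.
-/
import Literature.Probability.FitznerVanDerHofstad2017.SrwIntegralMonotone
import HarnessLib

/-!
# Far-field reduction for `𝓙_{n,l}(x)` (the F-IM gap)

[NoBLE17] R. Fitzner, R. van der Hofstad, *Generalized approach to the non-backtracking lace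
expansion*, PTRF 169 (2017) 1041–1119, bounds the initial point of the bootstrap function `f₃` by
`((2d-2)/(2d-1)) · max_{(n,l,S)} sup_{x ∈ S} 𝓙_{n,l}(x) / c_{n,l,S}` ((3.30)–(3.31) p. 1070), with
`𝓙_{n,l}(x) = I_{n+2,l+1}(x) − (1/d) I_{n+3,l}(x) + (1/(2d²)) Σ_{ι ∈ {±1,…,±d}} I_{n+3,l}(x + 2e_ι)`
(arXiv:1506.07969 TeX l.1902; R. Fitzner, PhD thesis (TU/e 2013) (3.6.16)–(3.6.18) p. 101 writes
`I^M_{n,l}`; the notebook `SRW.nb` computes it as `IM[n,l,x]`).  The Mathematica implementation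
realises the sup over the infinite sets `S ∈ {x ≠ 0}, {‖x‖₁ ≥ 2}, {‖x‖₁ ≥ 3}` as the maximum over
the three lowest-order nodes, justified in the thesis ((3.6.19) p. 102) by "the monotonicity of
`I_{n,m}` and symmetry".  But `𝓙` is a SIGNED combination of TRANSLATES of `I_{n+3,l}`: it is not
monotone in `|x_μ|` in general (`𝓙_{0,0}(0) = 0 < 𝓙_{0,0}(e₁)`; `𝓙_{−1,l}` fails at several
nodes — b2b-lace GAPS, literature seat gen 5 (iii)), so Lemma M (`absMonotone_srwI`) does not
give (3.6.19).  This was the packet's last analytic conditional ("D41 open", REFEREE v13–v16,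
condition C22 (ii)).

This file proves an UNCONDITIONAL far-field bound which turns every such sup into a finite
computation.  We index by `N = n + 2 ≥ 0` (so `IM[n,l,·] = srwJ d (n+2) l`) and write `f = I_{N+1,l}`.

* `srwJ_le_inward` (THM A): for every `x ∈ ℤ^d`,
  `𝓙 ≤ I_{N,l+1}(x) + (1/(2d²)) Σ_{ι : |x_ι| ≥ 2} [f(x − 2 sgn(x_ι) e_ι) − f(x)]`:
  only the INWARD double shifts survive, the `2d` dominated shifts cancel `−f/d` exactly.  Uses only
  `AbsMonotone f` (Lemma M; `d ≥ 2N + 3`).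
* `srwJ_farField` (THM B): if `I_{N,l+1} ≤ Ī` on the layer `{z ≥ 0 : Σ_μ z_μ = r}` and `f ≤ F̄` on the
  layer `r − 2`, then `𝓙(x) ≤ Ī + F̄/(2d)` for EVERY `x` with `‖x‖₁ ≥ r` (`N ≥ 1`, `d ≥ 2N + 3`,
  `r ≥ 2`).  `srwJ_farField'` is the refinement `Ī + B`, `B ≥ s F̄ₛ/(2d²)` for `1 ≤ s ≤ d`, `F̄ₛ` a
  bound on the layer `max(r, 2s) − 2` (because `‖x‖₁ ≥ 2 · #{ι : |x_ι| ≥ 2}`).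
* `srwJ_sup_of_layers` (THM C): `𝓙(x) ≤ B` for ALL `x` with `‖x‖₁ ≥ r₀`, from finitely many
  inequalities: `𝓙 ≤ B` on `r₀ ≤ ‖x‖₁ < r`, and `Ī + F̄/(2d) ≤ B`.
* tools: `srwJ_spAct` (`𝓙(σx) = 𝓙(x)`, `σ ∈ W_d`: every finite list reduces to sorted
  representatives), `layerBound_mono` (a bound on a layer bounds every deeper layer),
  `exists_layer_le_abs`, `srwI_nonneg`.

Float forecast (b2b-lace `b2b-lace-lit/g6/fimfar_d11.log`): at `d = 11` every `IM` cell consumed by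
`Percolation.nb` closes with `r ≤ 5` (the `S = {x ≠ 0}` cells at `r = 3` with NO extra inner point; the
`{‖x‖₁ ≥ 3}` cells' extra inner points are the layer-4 nodes already tabulated by both engines).  The
numerical premises (`Ī`, `F̄`, the inner values) are engine inputs, not proved here.
-/

namespace Literature.Probability.FitznerVanDerHofstad2017

open MeasureTheory Finset Real Filter Topology
open Literature.Barriers.CriticalPhenomena
open Literature.Barriers.CriticalPhenomena.LongRangePhi4 (srwLaw_nonneg)

variable {d : ℕ}

/-! ### The object -/

/-- **`𝓙_{N−2,l}(x)`** ([NoBLE17] `\mathcal J_{n,l}`, thesis `I^M_{n,l}`, `SRW.nb` `IM[n,l,x]`, with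
`N = n + 2`):
`𝓙 = I_{N,l+1}(x) − (1/d) I_{N+1,l}(x) + (1/(2d²)) Σ_{ι=1}^{d} [I_{N+1,l}(x + 2e_ι) + I_{N+1,l}(x − 2e_ι)]`
(the printed `Σ_ι` runs over `ι ∈ {−d,…,−1,1,…,d}`, [NoBLE17] §2.1 p. 1049).
[cite: FitznerVanDerHofstad2016NoBLE, (3.30) p. 1070; Fitzner2013Thesis, (3.6.18) p. 101] -/
noncomputable def srwJ (d N l : ℕ) (x : Fin d → ℤ) : ℝ :=
  srwI d N (l + 1) x - srwI d (N + 1) l x / d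
    + (∑ ι : Fin d, (srwI d (N + 1) l (x + axisVec ι 2) + srwI d (N + 1) l (x - axisVec ι 2)))
        / (2 * (d : ℝ) ^ 2)

/-- Unfolding lemma for `srwJ`. [cite: FitznerVanDerHofstad2016NoBLE, (3.30) p. 1070] -/
theorem srwJ_def (N l : ℕ) (x : Fin d → ℤ) :
    srwJ d N l x = srwI d N (l + 1) x - srwI d (N + 1) l x / d
      + (∑ ι : Fin d, (srwI d (N + 1) l (x + axisVec ι 2) + srwI d (N + 1) l (x - axisVec ι 2)))
          / (2 * (d : ℝ) ^ 2) := rfl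

/-! ### Small tools: axis vectors, layers, non-negativity, invariance -/

/-- `(a e_ι)_μ`. [folklore] -/
theorem axisVec_apply' (ι : Fin d) (a : ℤ) (μ : Fin d) :
    axisVec ι a μ = if μ = ι then a else 0 := rfl

/-- `(-a) e_ι = -(a e_ι)`. [folklore] -/
theorem axisVec_neg (ι : Fin d) (a : ℤ) : axisVec ι (-a) = -axisVec ι a := by
  funext μ; simp only [axisVec_apply', Pi.neg_apply]; split_ifs <;> simp

/-- `Σ_μ (a e_ι)_μ = a`. [folklore] -/
theorem sum_axisVec (hd : 0 < d) (ι : Fin d) (a : ℤ) : ∑ μ, axisVec ι a μ = a := by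
  have : Nonempty (Fin d) := ⟨⟨0, hd⟩⟩
  simp [axisVec_apply', Finset.sum_ite_eq']

/-- **`I_{n,l}(x) ≥ 0`** for `d ≥ 2n+1` (`I_{0,l} = p_l ≥ 0`; `I_{n+1,l} = Σ_{j} I_{n,l+j}`).
[cite: Fitzner2013Thesis, p. 101 ("The function I_{n,m} is non-negative")] -/
theorem srwI_nonneg : ∀ (n : ℕ), 2 * n + 1 ≤ d → ∀ (l : ℕ) (x : Fin d → ℤ), 0 ≤ srwI d n l x := by
  intro n
  induction n with
  | zero =>
      intro _ l x
      rw [srwI_zero_eq_srwLaw]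
      exact srwLaw_nonneg l x
  | succ n ih =>
      intro hd l x
      have hd' : 2 * n + 1 ≤ d := by omega
      refine ge_of_tendsto' (tendsto_sum_range_srwI hd l x) fun L => ?_
      exact Finset.sum_nonneg fun j _ => ih hd' (l + j) x

/-- LAYER EXISTENCE: every `x` with `‖x‖₁ ≥ r` dominates (coordinatewise in absolute value) some
`z ≥ 0` with `Σ_μ z_μ = r`. [folklore] -/
theorem exists_layer_le_abs (x : Fin d → ℤ) :
    ∀ (r : ℕ), (r : ℤ) ≤ ∑ μ, |x μ| →
      ∃ z : Fin d → ℤ, (∀ μ, 0 ≤ z μ) ∧ (∀ μ, z μ ≤ |x μ|) ∧ ∑ μ, z μ = r := by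
  intro r
  induction r with
  | zero =>
      intro _
      exact ⟨0, fun μ => le_rfl, fun μ => abs_nonneg _, by simp⟩
  | succ r ih =>
      intro hr
      obtain ⟨z, hz0, hzle, hsum⟩ := ih (by push_cast at hr ⊢; omega)
      have hlt : ∑ μ, z μ < ∑ μ, |x μ| := by rw [hsum]; push_cast at hr ⊢; omega
      obtain ⟨μ₀, -, hμ₀⟩ := Finset.exists_lt_of_sum_lt hlt
      have hd : 0 < d := Fin.pos μ₀
      refine ⟨z + axisVec μ₀ 1, fun μ => ?_, fun μ => ?_, ?_⟩
      · simp only [Pi.add_apply, axisVec_apply']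
        split_ifs <;> linarith [hz0 μ]
      · simp only [Pi.add_apply, axisVec_apply']
        split_ifs with h
        · subst h; linarith [hμ₀]
        · simpa using hzle μ
      · simp only [Pi.add_apply]
        rw [Finset.sum_add_distrib, hsum, sum_axisVec hd]
        push_cast; ring

/-- LAYER REDUCTION for an `AbsMonotone` function: a bound on the layer `{z ≥ 0 : Σ z_μ = r}`
bounds `f` on all of `{‖x‖₁ ≥ r}`. [folklore] -/
theorem AbsMonotone.le_of_layer {f : (Fin d → ℤ) → ℝ} (hf : AbsMonotone f) {r : ℕ} {F : ℝ}
    (hF : ∀ z : Fin d → ℤ, (∀ μ, 0 ≤ z μ) → ∑ μ, z μ = r → f z ≤ F)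
    (x : Fin d → ℤ) (hx : (r : ℤ) ≤ ∑ μ, |x μ|) : f x ≤ F := by
  obtain ⟨z, hz0, hzle, hsum⟩ := exists_layer_le_abs x r hx
  refine le_trans (hf x z fun μ => ?_) (hF z hz0 hsum)
  rw [abs_of_nonneg (hz0 μ)]
  exact hzle μ

/-- LAYER MONOTONICITY: for an `AbsMonotone` `f`, a bound on the layer `m` is a bound on every
deeper layer `m' ≥ m` (so an engine may cap the layer index). [folklore] -/
theorem layerBound_mono {f : (Fin d → ℤ) → ℝ} (hf : AbsMonotone f) {m m' : ℕ} (hmm' : m ≤ m')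
    {F : ℝ} (hF : ∀ z : Fin d → ℤ, (∀ μ, 0 ≤ z μ) → ∑ μ, z μ = m → f z ≤ F)
    (y : Fin d → ℤ) (hy0 : ∀ μ, 0 ≤ y μ) (hsum : ∑ μ, y μ = m') : f y ≤ F := by
  refine hf.le_of_layer hF y ?_
  have : ∑ μ, |y μ| = ∑ μ, y μ := Finset.sum_congr rfl fun μ _ => abs_of_nonneg (hy0 μ)
  rw [this, hsum]
  exact_mod_cast hmm'

/-- `σx + a e_ι = σ(x + (δ_ι a) e_{ν ι})` for `σ = (ν, δ) ∈ W_d`. [folklore] -/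
theorem spAct_add_axisVec (τ : SgnPermPair d) (x : Fin d → ℤ) (ι : Fin d) (a : ℤ) :
    spAct τ x + axisVec ι a = spAct τ (x + axisVec (τ.1 ι) ((τ.2 ι : ℤ) * a)) := by
  funext i
  simp only [Pi.add_apply, spAct_apply, axisVec_apply']
  have hu : (τ.2 i : ℤ) * (τ.2 i : ℤ) = 1 := by
    rw [← Units.val_mul, Int.units_mul_self, Units.val_one]
  by_cases h : i = ι
  · subst h
    simp only [if_true, mul_add, ← mul_assoc, hu, one_mul]
  · have hne : τ.1 i ≠ τ.1 ι := fun e => h (τ.1.injective e)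
    simp [h, hne]

/-- `σx − a e_ι = σ(x − (δ_ι a) e_{ν ι})` for `σ = (ν, δ) ∈ W_d`. [folklore] -/
theorem spAct_sub_axisVec (τ : SgnPermPair d) (x : Fin d → ℤ) (ι : Fin d) (a : ℤ) :
    spAct τ x - axisVec ι a = spAct τ (x - axisVec (τ.1 ι) ((τ.2 ι : ℤ) * a)) := by
  rw [sub_eq_add_neg, ← axisVec_neg, spAct_add_axisVec, mul_neg, axisVec_neg, ← sub_eq_add_neg]

/-- **`𝓙(σx) = 𝓙(x)`** for every signed permutation `σ ∈ W_d`: every finite node list may be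
reduced to sorted non-negative representatives. [cite: FitznerVanDerHofstad2016NoBLE, (3.34)–(3.35) p. 1071] -/
theorem srwJ_spAct (N l : ℕ) (τ : SgnPermPair d) (x : Fin d → ℤ) :
    srwJ d N l (spAct τ x) = srwJ d N l x := by
  unfold srwJ
  rw [srwI_spAct, srwI_spAct]
  congr 1
  congr 1
  -- the shift sum: reindex `ι ↦ ν ι` and absorb the sign `δ_ι` into the pair `±`
  have hpair : ∀ ι : Fin d,
      srwI d (N + 1) l (spAct τ x + axisVec ι 2) + srwI d (N + 1) l (spAct τ x - axisVec ι 2) =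
        srwI d (N + 1) l (x + axisVec (τ.1 ι) 2) + srwI d (N + 1) l (x - axisVec (τ.1 ι) 2) := by
    intro ι
    rw [spAct_add_axisVec, spAct_sub_axisVec, srwI_spAct, srwI_spAct]
    rcases Int.units_eq_one_or (τ.2 ι) with hu | hu
    · rw [hu, Units.val_one, one_mul]
    · rw [hu, Units.val_neg, Units.val_one, neg_mul, one_mul, axisVec_neg, ← sub_eq_add_neg,
        sub_neg_eq_add]
      exact add_comm _ _
  simp_rw [hpair]
  exact Equiv.sum_comp τ.1 (fun j => srwI d (N + 1) l (x + axisVec j 2) + srwI d (N + 1) l (x - axisVec j 2))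

/-! ### THM A — the pointwise inward bound -/

/-- `|a| ≤ |a + 2|` for `a ≥ −1`. [folklore] -/
theorem abs_le_abs_add_two {a : ℤ} (h : -1 ≤ a) : |a| ≤ |a + 2| :=
  abs_le.mpr ⟨by linarith [le_abs_self (a + 2)], by linarith [le_abs_self (a + 2)]⟩

/-- `|a| ≤ |a − 2|` for `a ≤ 1`. [folklore] -/
theorem abs_le_abs_sub_two {a : ℤ} (h : a ≤ 1) : |a| ≤ |a - 2| :=
  abs_le.mpr ⟨by linarith [neg_abs_le (a - 2)], by linarith [neg_abs_le (a - 2)]⟩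

/-- The per-direction step of THM A: for `f` `AbsMonotone`,
`f(x + 2e_ι) + f(x − 2e_ι) ≤ 2 f(x) + [ |x_ι| ≥ 2 ] · (f(x − 2 sgn(x_ι) e_ι) − f(x))`. [folklore] -/
theorem shift_two_pair_le {f : (Fin d → ℤ) → ℝ} (hf : AbsMonotone f) (x : Fin d → ℤ) (ι : Fin d) :
    f (x + axisVec ι 2) + f (x - axisVec ι 2) ≤
      2 * f x + (if 2 ≤ |x ι| then f (x - axisVec ι (2 * Int.sign (x ι))) - f x else 0) := by
  -- domination tests for the two shifts
  have hplus : -1 ≤ x ι → f (x + axisVec ι 2) ≤ f x := by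
    intro h
    refine hf _ _ fun μ => ?_
    simp only [Pi.add_apply, axisVec_apply']
    split_ifs with hμ
    · subst hμ; exact abs_le_abs_add_two h
    · simp
  have hminus : x ι ≤ 1 → f (x - axisVec ι 2) ≤ f x := by
    intro h
    refine hf _ _ fun μ => ?_
    simp only [Pi.sub_apply, axisVec_apply']
    split_ifs with hμ
    · subst hμ; exact abs_le_abs_sub_two h
    · simp
  by_cases h2 : 2 ≤ |x ι|
  · rw [if_pos h2]
    rcases le_or_gt 0 (x ι) with hx | hx
    · -- `x_ι ≥ 2`: outward `+` dominated, inward `−` kept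
      have hx2 : 2 ≤ x ι := by rw [abs_of_nonneg hx] at h2; exact h2
      have hs : Int.sign (x ι) = 1 := Int.sign_eq_one_of_pos (by omega)
      rw [hs, mul_one]
      linarith [hplus (by omega)]
    · -- `x_ι ≤ −2`: outward `−` dominated, inward `+` kept
      have hx2 : x ι ≤ -2 := by rw [abs_of_neg hx] at h2; omega
      have hs : Int.sign (x ι) = -1 := Int.sign_eq_neg_one_of_neg hx
      rw [hs, show (2 : ℤ) * -1 = -2 by norm_num, axisVec_neg, sub_neg_eq_add]
      linarith [hminus (by omega)]
  · rw [if_neg h2, add_zero, two_mul]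
    have h1 := abs_lt.mp (not_le.mp h2)
    exact add_le_add (hplus (by omega)) (hminus (by omega))

/-- **THM A (pointwise inward bound).**  For `d ≥ 2N + 3`, every `l` and EVERY `x ∈ ℤ^d`,
`𝓙_{N−2,l}(x) ≤ I_{N,l+1}(x) + (1/(2d²)) Σ_{ι : |x_ι| ≥ 2} [ I_{N+1,l}(x − 2 sgn(x_ι) e_ι) − I_{N+1,l}(x) ]`.
Only Lemma M for `I_{N+1,l}` is used: the `2d` shifts that are `|·|`-dominated by `x` (all of them
when `x ∈ {−1,0,1}^d`) contribute at most `(2d)·f(x)/(2d²) = f(x)/d`, which cancels the `−f(x)/d` of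
`𝓙` exactly.  (b2b-lace, literature seat gen 6.) [folklore] -/
theorem srwJ_le_inward {N : ℕ} (hd : 2 * (N + 1) + 1 ≤ d) (l : ℕ) (x : Fin d → ℤ) :
    srwJ d N l x ≤ srwI d N (l + 1) x
      + (∑ ι : Fin d, if 2 ≤ |x ι| then
          srwI d (N + 1) l (x - axisVec ι (2 * Int.sign (x ι))) - srwI d (N + 1) l x else 0)
        / (2 * (d : ℝ) ^ 2) := by
  have hf : AbsMonotone (srwI d (N + 1) l) := absMonotone_srwI (by omega) hd l
  have hdpos : (0 : ℝ) < d := by exact_mod_cast (show 0 < d by omega)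
  set S := ∑ ι : Fin d, (if 2 ≤ |x ι| then
      srwI d (N + 1) l (x - axisVec ι (2 * Int.sign (x ι))) - srwI d (N + 1) l x else 0) with hS
  have hsum : ∑ ι : Fin d, (srwI d (N + 1) l (x + axisVec ι 2) + srwI d (N + 1) l (x - axisVec ι 2))
      ≤ (d : ℝ) * (2 * srwI d (N + 1) l x) + S := by
    calc ∑ ι : Fin d, (srwI d (N + 1) l (x + axisVec ι 2) + srwI d (N + 1) l (x - axisVec ι 2))
        ≤ ∑ ι : Fin d, (2 * srwI d (N + 1) l x + (if 2 ≤ |x ι| then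
            srwI d (N + 1) l (x - axisVec ι (2 * Int.sign (x ι))) - srwI d (N + 1) l x else 0)) :=
          Finset.sum_le_sum fun ι _ => shift_two_pair_le hf x ι
      _ = (d : ℝ) * (2 * srwI d (N + 1) l x) + S := by
          rw [Finset.sum_add_distrib, Finset.sum_const, Finset.card_univ, Fintype.card_fin,
            nsmul_eq_mul]
  rw [srwJ_def]
  have h1 : (∑ ι : Fin d, (srwI d (N + 1) l (x + axisVec ι 2) + srwI d (N + 1) l (x - axisVec ι 2)))
        / (2 * (d : ℝ) ^ 2) ≤ ((d : ℝ) * (2 * srwI d (N + 1) l x) + S) / (2 * (d : ℝ) ^ 2) :=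
    div_le_div_of_nonneg_right hsum (by positivity)
  have h2 : ((d : ℝ) * (2 * srwI d (N + 1) l x) + S) / (2 * (d : ℝ) ^ 2)
      = srwI d (N + 1) l x / d + S / (2 * (d : ℝ) ^ 2) := by
    field_simp
  linarith [h1, h2]

/-! ### THM B — the far field -/

/-- `‖x − 2 sgn(x_ι) e_ι‖₁ = ‖x‖₁ − 2` when `|x_ι| ≥ 2`. [folklore] -/
theorem sum_abs_inward (x : Fin d → ℤ) (ι : Fin d) (h : 2 ≤ |x ι|) :
    ∑ μ, |(x - axisVec ι (2 * Int.sign (x ι))) μ| = (∑ μ, |x μ|) - 2 := by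
  have hpt : ∀ μ, |(x - axisVec ι (2 * Int.sign (x ι))) μ| = |x μ| - (if μ = ι then 2 else 0) := by
    intro μ
    simp only [Pi.sub_apply, axisVec_apply']
    split_ifs with hμ
    · subst hμ
      rcases le_or_gt 0 (x μ) with hx | hx
      · have hx2 : 2 ≤ x μ := by rw [abs_of_nonneg hx] at h; exact h
        rw [Int.sign_eq_one_of_pos (by omega), mul_one, abs_of_nonneg hx,
          abs_of_nonneg (by omega : (0:ℤ) ≤ x μ - 2)]
      · have hx2 : x μ ≤ -2 := by rw [abs_of_neg hx] at h; omega
        rw [Int.sign_eq_neg_one_of_neg hx, abs_of_neg hx,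
          abs_of_nonpos (by omega : x μ - 2 * -1 ≤ 0)]
        ring
    · simp
  have hd : 0 < d := Fin.pos ι
  have : Nonempty (Fin d) := ⟨ι⟩
  simp_rw [hpt]
  rw [Finset.sum_sub_distrib]
  simp

/-- **THM B (far-field bound, crude form).**  Let `N ≥ 1`, `d ≥ 2N + 3`, `r ≥ 2`.  If
`I_{N,l+1}(z) ≤ Ī` for all `z ≥ 0` with `Σ_μ z_μ = r` and `I_{N+1,l}(y) ≤ F̄` for all `y ≥ 0` with
`Σ_μ y_μ = r − 2` (two FINITE lists, `W_d`-reducible by `srwI_spAct`), then for EVERY `x ∈ ℤ^d` with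
`‖x‖₁ ≥ r`:  `𝓙_{N−2,l}(x) ≤ Ī + F̄/(2d)`.
Proof: THM A; `I_{N,l+1}(x) ≤ Ī` and each inward value `≤ F̄` by Lemma M + layer reduction;
`I ≥ 0`; at most `d` inward directions.  (b2b-lace, literature seat gen 6.) [folklore] -/
theorem srwJ_farField {N : ℕ} (hN : 1 ≤ N) (hd : 2 * (N + 1) + 1 ≤ d) (l : ℕ) {r : ℕ} (hr : 2 ≤ r)
    {Ibar Fbar : ℝ}
    (hI : ∀ z : Fin d → ℤ, (∀ μ, 0 ≤ z μ) → ∑ μ, z μ = r → srwI d N (l + 1) z ≤ Ibar)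
    (hF : ∀ y : Fin d → ℤ, (∀ μ, 0 ≤ y μ) → ∑ μ, y μ = (r - 2 : ℕ) → srwI d (N + 1) l y ≤ Fbar)
    (x : Fin d → ℤ) (hx : (r : ℤ) ≤ ∑ μ, |x μ|) :
    srwJ d N l x ≤ Ibar + Fbar / (2 * d) := by
  have hdn : 0 < d := by omega
  have hdpos : (0 : ℝ) < d := by exact_mod_cast hdn
  have hfI : AbsMonotone (srwI d N (l + 1)) := absMonotone_srwI hN (by omega) (l + 1)
  have hf : AbsMonotone (srwI d (N + 1) l) := absMonotone_srwI (by omega) hd l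
  -- `F̄ ≥ 0`: it bounds `f ≥ 0` at the axis point `(r-2) e_0`
  have hF0 : 0 ≤ Fbar := by
    let ι₀ : Fin d := ⟨0, hdn⟩
    have h1 := hF (axisVec ι₀ ((r - 2 : ℕ) : ℤ)) (fun μ => by
      simp only [axisVec_apply']; split_ifs <;> positivity) (sum_axisVec hdn ι₀ _)
    exact le_trans (srwI_nonneg (N + 1) hd l _) h1
  -- THM A
  refine le_trans (srwJ_le_inward hd l x) ?_
  have h1 : srwI d N (l + 1) x ≤ Ibar := hfI.le_of_layer hI x hx
  have h2 : (∑ ι : Fin d, if 2 ≤ |x ι| then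
        srwI d (N + 1) l (x - axisVec ι (2 * Int.sign (x ι))) - srwI d (N + 1) l x else 0)
      ≤ ∑ _ι : Fin d, Fbar := by
    refine Finset.sum_le_sum fun ι _ => ?_
    split_ifs with hι
    · have hy : ((r - 2 : ℕ) : ℤ) ≤ ∑ μ, |(x - axisVec ι (2 * Int.sign (x ι))) μ| := by
        rw [sum_abs_inward x ι hι]; push_cast [Nat.cast_sub hr]; linarith
      have := hf.le_of_layer hF _ hy
      linarith [srwI_nonneg (N + 1) hd l x]
    · exact hF0
  rw [Finset.sum_const, Finset.card_univ, Fintype.card_fin, nsmul_eq_mul] at h2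
  have h3 : (∑ ι : Fin d, if 2 ≤ |x ι| then
        srwI d (N + 1) l (x - axisVec ι (2 * Int.sign (x ι))) - srwI d (N + 1) l x else 0)
      / (2 * (d : ℝ) ^ 2) ≤ Fbar / (2 * d) := by
    rw [div_le_div_iff₀ (by positivity) (by positivity)]
    nlinarith [h2, hdpos, hF0]
  linarith [h1, h3]

/-- **THM B′ (far-field bound, refined form).**  As `srwJ_farField`, but using that `x` has at most
`s ≤ min(d, ‖x‖₁/2)` coordinates with `|x_ι| ≥ 2`: if `F̄ s` bounds `I_{N+1,l}` on the layer
`max(r, 2s) − 2` for each `1 ≤ s ≤ d`, and `B ≥ s · F̄ s/(2d²)` for each such `s` (and `B ≥ 0`), then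
`𝓙_{N−2,l}(x) ≤ Ī + B` for every `‖x‖₁ ≥ r`.  (b2b-lace, literature seat gen 6.) [folklore] -/
theorem srwJ_farField' {N : ℕ} (hN : 1 ≤ N) (hd : 2 * (N + 1) + 1 ≤ d) (l : ℕ) {r : ℕ} (hr : 2 ≤ r)
    {Ibar B : ℝ} (Fb : ℕ → ℝ)
    (hI : ∀ z : Fin d → ℤ, (∀ μ, 0 ≤ z μ) → ∑ μ, z μ = r → srwI d N (l + 1) z ≤ Ibar)
    (hF : ∀ s : ℕ, 1 ≤ s → s ≤ d → ∀ y : Fin d → ℤ, (∀ μ, 0 ≤ y μ) →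
      ∑ μ, y μ = (max r (2 * s) - 2 : ℕ) → srwI d (N + 1) l y ≤ Fb s)
    (hB : ∀ s : ℕ, 1 ≤ s → s ≤ d → (s : ℝ) * Fb s / (2 * (d : ℝ) ^ 2) ≤ B) (hB0 : 0 ≤ B)
    (x : Fin d → ℤ) (hx : (r : ℤ) ≤ ∑ μ, |x μ|) :
    srwJ d N l x ≤ Ibar + B := by
  have hdn : 0 < d := by omega
  have hdpos : (0 : ℝ) < d := by exact_mod_cast hdn
  have hfI : AbsMonotone (srwI d N (l + 1)) := absMonotone_srwI hN (by omega) (l + 1)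
  have hf : AbsMonotone (srwI d (N + 1) l) := absMonotone_srwI (by omega) hd l
  refine le_trans (srwJ_le_inward hd l x) ?_
  have h1 : srwI d N (l + 1) x ≤ Ibar := hfI.le_of_layer hI x hx
  -- the set of inward directions and its size
  set T : Finset (Fin d) := Finset.univ.filter (fun ι => 2 ≤ |x ι|) with hT
  set s := T.card with hs
  have hsd : s ≤ d := by
    rw [hs, hT]; exact (Finset.card_filter_le _ _).trans (by simp)
  -- `‖x‖₁ ≥ 2s`
  have hx2 : (2 * s : ℤ) ≤ ∑ μ, |x μ| := by
    have hTsum : ∑ μ ∈ T, |x μ| ≤ ∑ μ, |x μ| :=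
      Finset.sum_le_sum_of_subset_of_nonneg (Finset.filter_subset _ _) fun μ _ _ => abs_nonneg _
    have hTge : (2 * s : ℤ) ≤ ∑ μ ∈ T, |x μ| := by
      have : ∑ _μ ∈ T, (2 : ℤ) ≤ ∑ μ ∈ T, |x μ| :=
        Finset.sum_le_sum fun μ hμ => by rw [hT, Finset.mem_filter] at hμ; exact hμ.2
      rw [Finset.sum_const, nsmul_eq_mul] at this
      rw [hs]; linarith
    exact hTge.trans hTsum
  -- rewrite the `ite` sum as a sum over `T`
  have hite : (∑ ι : Fin d, if 2 ≤ |x ι| then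
        srwI d (N + 1) l (x - axisVec ι (2 * Int.sign (x ι))) - srwI d (N + 1) l x else 0)
      = ∑ ι ∈ T, (srwI d (N + 1) l (x - axisVec ι (2 * Int.sign (x ι))) - srwI d (N + 1) l x) := by
    rw [hT, Finset.sum_filter]
  rw [hite]
  rcases Nat.eq_zero_or_pos s with hs0 | hspos
  · have hT0 : T = ∅ := Finset.card_eq_zero.mp (by rw [← hs, hs0])
    rw [hT0, Finset.sum_empty, zero_div, add_zero]
    linarith
  · have hterm : ∀ ι ∈ T,
        srwI d (N + 1) l (x - axisVec ι (2 * Int.sign (x ι))) - srwI d (N + 1) l x ≤ Fb s := by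
      intro ι hι
      have hι : 2 ≤ |x ι| := by rw [hT, Finset.mem_filter] at hι; exact hι.2
      have hm : 2 ≤ max r (2 * s) := le_max_of_le_left hr
      have hmax : ((max r (2 * s) : ℕ) : ℤ) ≤ ∑ μ, |x μ| := by
        rcases le_total r (2 * s) with h | h
        · rw [max_eq_right h]; push_cast; exact hx2
        · rw [max_eq_left h]; exact hx
      have hy : ((max r (2 * s) - 2 : ℕ) : ℤ) ≤ ∑ μ, |(x - axisVec ι (2 * Int.sign (x ι))) μ| := by
        rw [sum_abs_inward x ι hι, Nat.cast_sub hm]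
        push_cast at hmax ⊢
        linarith
      have := hf.le_of_layer (hF s hspos hsd) _ hy
      linarith [srwI_nonneg (N + 1) hd l x]
    have h2 : ∑ ι ∈ T, (srwI d (N + 1) l (x - axisVec ι (2 * Int.sign (x ι))) - srwI d (N + 1) l x)
        ≤ s * Fb s := by
      have := Finset.sum_le_sum hterm
      rw [Finset.sum_const, nsmul_eq_mul, ← hs] at this
      exact this
    have h3 : (∑ ι ∈ T, (srwI d (N + 1) l (x - axisVec ι (2 * Int.sign (x ι))) - srwI d (N + 1) l x))
        / (2 * (d : ℝ) ^ 2) ≤ B :=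
      le_trans (div_le_div_of_nonneg_right h2 (by positivity)) (hB s hspos hsd)
    linarith [h1, h3]

/-! ### THM C — the sup over an infinite region from finitely many inequalities -/

/-- **THM C (finite reduction of `sup_{‖x‖₁ ≥ r₀} 𝓙`).**  Let `N ≥ 1`, `d ≥ 2N+3`, `2 ≤ r`.  Suppose
(inner, finite) `𝓙_{N−2,l}(x) ≤ B` for every `x` with `r₀ ≤ ‖x‖₁ < r`, and (far, finite) the layer
bounds `Ī` (for `I_{N,l+1}` on layer `r`) and `F̄` (for `I_{N+1,l}` on layer `r − 2`) satisfy
`Ī + F̄/(2d) ≤ B`.  Then `𝓙_{N−2,l}(x) ≤ B` for EVERY `x` with `‖x‖₁ ≥ r₀`.  With `r₀ = 1, 2, 3` this is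
the printed `sup_{x ≠ 0}`, `sup_{‖x‖₁ ≥ 2}`, `sup_{‖x‖₁ ≥ 3}` of [NoBLE17] (3.30) / thesis (3.6.19) /
`SRW.nb`'s node lists, now as a theorem modulo finitely many certified evaluations.
(b2b-lace, literature seat gen 6.) [cite: FitznerVanDerHofstad2016NoBLE, (3.30)–(3.31) p. 1070] -/
theorem srwJ_sup_of_layers {N : ℕ} (hN : 1 ≤ N) (hd : 2 * (N + 1) + 1 ≤ d) (l : ℕ) {r₀ r : ℕ}
    (hr : 2 ≤ r) {Ibar Fbar B : ℝ}
    (hin : ∀ x : Fin d → ℤ, (r₀ : ℤ) ≤ ∑ μ, |x μ| → (∑ μ, |x μ|) < r → srwJ d N l x ≤ B)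
    (hI : ∀ z : Fin d → ℤ, (∀ μ, 0 ≤ z μ) → ∑ μ, z μ = r → srwI d N (l + 1) z ≤ Ibar)
    (hF : ∀ y : Fin d → ℤ, (∀ μ, 0 ≤ y μ) → ∑ μ, y μ = (r - 2 : ℕ) → srwI d (N + 1) l y ≤ Fbar)
    (hfar : Ibar + Fbar / (2 * d) ≤ B)
    (x : Fin d → ℤ) (hx : (r₀ : ℤ) ≤ ∑ μ, |x μ|) : srwJ d N l x ≤ B := by
  rcases lt_or_ge (∑ μ, |x μ|) (r : ℤ) with hlt | hle
  · exact hin x hx hlt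
  · exact (srwJ_farField hN hd l hr hI hF x hle).trans hfar

/-- `x ≠ 0 ↔ ‖x‖₁ ≥ 1` (the region `S = {x ≠ 0}` of (3.6.19) is `r₀ = 1`). [folklore] -/
theorem one_le_sum_abs_iff (x : Fin d → ℤ) : (1 : ℤ) ≤ ∑ μ, |x μ| ↔ x ≠ 0 := by
  constructor
  · rintro h rfl
    simp at h
  · intro hx
    obtain ⟨μ, hμ⟩ := Function.ne_iff.mp hx
    have h1 : (1 : ℤ) ≤ |x μ| := Int.one_le_abs hμ
    exact h1.trans (Finset.single_le_sum (fun ν _ => abs_nonneg (x ν)) (Finset.mem_univ μ))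

/-- **THM C for `S = {x ≠ 0}`** (the three-node rule (3.6.19) made a theorem modulo finitely many
evaluations): with `r = 3` the inner list is exactly `{‖x‖₁ ∈ {1,2}}`, i.e. the `W_d`-orbits of the
printed nodes `e₁, 2e₁, e₁ + e₂` themselves. [cite: Fitzner2013Thesis, (3.6.19) p. 102] -/
theorem srwJ_sup_ne_zero {N : ℕ} (hN : 1 ≤ N) (hd : 2 * (N + 1) + 1 ≤ d) (l : ℕ) {r : ℕ}
    (hr : 2 ≤ r) {Ibar Fbar B : ℝ}
    (hin : ∀ x : Fin d → ℤ, x ≠ 0 → (∑ μ, |x μ|) < r → srwJ d N l x ≤ B)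
    (hI : ∀ z : Fin d → ℤ, (∀ μ, 0 ≤ z μ) → ∑ μ, z μ = r → srwI d N (l + 1) z ≤ Ibar)
    (hF : ∀ y : Fin d → ℤ, (∀ μ, 0 ≤ y μ) → ∑ μ, y μ = (r - 2 : ℕ) → srwI d (N + 1) l y ≤ Fbar)
    (hfar : Ibar + Fbar / (2 * d) ≤ B)
    (x : Fin d → ℤ) (hx : x ≠ 0) : srwJ d N l x ≤ B :=
  srwJ_sup_of_layers (r₀ := 1) hN hd l hr
    (fun x hx1 hlt => hin x ((one_le_sum_abs_iff x).mp hx1) hlt) hI hF hfar x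
    ((one_le_sum_abs_iff x).mpr hx)

end Literature.Probability.FitznerVanDerHofstad2017
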